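/-
Copyright (c) 2026. All rights reserved.
Released under Apache 2.0 license as described in the file LICENSE.
Authors: abc-iut cell, seat abc-iut-L4-t10 (gen 3; interface author of `AutHolFieldFunctor`; node
`AbsTopIII:Cor4.5` / `AbsTopIII:Prop4.2(i)` — id-rigidity of the geometric `EA` over the plane and the
punctured plane).
-/
import Literature.AnabelianGeometry.AbsoluteAnabelian.ArchimedeanHolFieldFunctorGeometricPlaneProofs
import Mathlib.Analysis.Complex.CoveringMap
import Mathlib.Algebra.Polynomial.Roots
import Mathlib.Geometry.Manifold.MFDeriv.FDeriv
import HarnessLib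

/-!
# [AbsTopIII] Prop 4.2 (i) / Cor 4.5 at the holomorphic geometric model: `EA` over the plane `ℂ` and the
# punctured plane `ℂ^×` is id-rigid — non-invertible finite étale maps `z ↦ zⁿ` inside genuine geometry

S. Mochizuki, *Topics in absolute anabelian geometry III*, Prop 4.2 (i) p. 105 ("In particular, the
categories `EA`, `𝒞^hol_T = 𝒞̲^hol_T` … are id-rigid"), proof p. 106, Def 4.1 (iii) p. 103 ("the finite
étale morphisms"), Cor 4.5 (i)–(v) pp. 107–110 of the author's kurims manuscript (lit key
`paper:url-5493eb38cbb7`, read on the page; bib key `MochizukiAbsTopIII2015`).  Companion (abc-iut cell,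
nodes `AbsTopIII:Prop4.2(i)`, `AbsTopIII:Cor4.5`) of abc-iut-L4-t14's `ArchimedeanHolFieldFunctorGeometric.lean`
(the interface `AutHolFieldFunctor` of abc-iut-L4-t10 on GEOMETRIC carriers: connected Riemann surfaces,
holomorphic finite étale maps, `𝒜_𝕏 = ℂ`, `𝒜_φ = id`; `EA^hol_RS(Q)` cut out by an object property `Q`),
whose model theorems keep ONE hypothesis `hE : IsIdRigid EA^hol_RS(Q)`; sequel of
`ArchimedeanHolFieldFunctorGeometricPlaneProofs.lean` (the case `Q = {ℂ}`, whose affine morphisms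
`exists_hom_plane_affine` are reused).

* `HolRS.puncturedPlane` — the punctured plane `ℂ^× = ℂ ∖ {0}` as an object of `HolRS` (abc-iut-L4-t14's
  `ofOpen`; connected since `rank_ℝ ℂ = 2 > 1`);
* its finite étale holomorphic self-maps: the dilations `z ↦ c·z` (`exists_hom_puncturedPlane_mul`,
  homeomorphisms) and the POWER MAPS `z ↦ zⁿ`, `n ≥ 1` (`exists_hom_puncturedPlane_pow`: holomorphic;
  finite étale by Mathlib's `isCoveringMap_npow` — "`(· ^ n) : 𝕜 ∖ {0} → 𝕜 ∖ {0}` is a covering map" —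
  with fibres inside the `n`-th roots, `Polynomial.nthRoots`); `z ↦ z²` is NOT an isomorphism
  (`exists_hom_puncturedPlane_not_isIso`: `(-1)² = 1²`) — so this `EA` has genuinely NON-INVERTIBLE finite
  étale morphisms, the situation of print (abc-iut-w5-d226's one-object toy p421760 realised inside
  geometry, her pointer (1) of 04:43Z);
* `HolRS.app_eq_id_of_obj_eq_plane` / `HolRS.app_eq_id_of_obj_eq_puncturedPlane` — for ANY `Q`, the
  component of an automorphism of `𝟭_{EA^hol_RS(Q)}` at an object whose underlying surface is `ℂ`
  (resp. `ℂ^×`) is the identity: at `ℂ`, commuting with the translations gives `g = (· + c)` and with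
  `z ↦ 2z` gives `c = 0`; at `ℂ^×`, commuting with the dilations gives `g z = d·z` (`d = g 1`) and with
  the squaring map gives `d² = d`, `d = 1`;
* `HolRS.isIdRigid_EA_of_subset_planes` — hence **`EA^hol_RS(Q)` is id-rigid for every `Q` all of whose
  objects are `ℂ` or `ℂ^×`**; `HolRS.isIdRigid_EA_planes` — the instance `Q = {ℂ, ℂ^×}`;
* `HolRS.cor_4_5_geometric_of_subset_planes`, **`HolRS.cor_4_5_geometric_planes`**, `HolRS.isIdRigid_pairs_planes`
  — Cor 4.5 (i)–(v) AS TYPED and Prop 4.2 (i)'s id-rigidity of `𝒞^hol_TF` / `𝒞^hol_T` hold OUTRIGHT for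
  the archimedean log-Frobenius data over the geometric carriers `{ℂ, ℂ^×}` (abc-iut-L4-t14's
  `cor_4_5_geometric` / `isIdRigid_pairs_of_isIdRigid_EA` with their hypothesis discharged).

HONEST SCOPE: `ℂ` and `ℂ^×` are not hyperbolic, let alone elliptically admissible (print's `EA`): they
are the universal covering of every elliptic curve and its quotient by a cyclic group; for hyperbolic `Q`
the id-rigidity is Lemma 4.3's slimness via Cor 2.3 (i) and Riemann existence (campaign-L; realised at the
Galois-category instance `AutHolFieldFunctor.ofGaloisCategory`, p421893).  Refereed pre-IUT anabelian
geometry; nothing here bears on [IUTchIII] Cor. 3.12 or takes a side; model ≠ reconstruction.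
-/

set_option autoImplicit false

noncomputable section

namespace Literature.AnabelianGeometry.AbsoluteAnabelian

open _root_.CategoryTheory _root_.Topology _root_.TopologicalSpace
open scoped _root_.Manifold _root_.ContDiff

namespace HolRS

/-! ### The punctured plane as a connected Riemann surface -/

/-- The open subset `ℂ ∖ {0}` of `ℂ`. [cite: MochizukiAbsTopIII2015, Definition 2.1 (i) p.50] -/
def puncturedPlaneOpens : Opens ℂ := ⟨{z : ℂ | z ≠ 0}, isOpen_ne⟩

/-- Membership in `ℂ ∖ {0}`. [cite: MochizukiAbsTopIII2015, Definition 2.1 (i) p.50] -/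
@[simp] theorem mem_puncturedPlaneOpens (z : ℂ) : z ∈ puncturedPlaneOpens ↔ z ≠ 0 := Iff.rfl

/-- `ℂ ∖ {0}` is connected (`ℂ` has real dimension `2 > 1`) — "connected Aut-holomorphic [spaces]".
[cite: MochizukiAbsTopIII2015, Definition 2.1 (i) p.50] -/
theorem isConnected_puncturedPlaneOpens : IsConnected (puncturedPlaneOpens : Set ℂ) := by
  have h : IsConnected ({0}ᶜ : Set ℂ) :=
    isConnected_compl_singleton_of_one_lt_rank (by simp [Complex.rank_real_complex]) 0
  convert h using 1
  ext z
  simp [puncturedPlaneOpens]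

/-- **The punctured plane `ℂ^× = ℂ ∖ {0}`** as a connected Riemann surface (an object of `TH`: an
Aut-holomorphic space in the sense of Def 2.1 (i); the quotient of the universal covering `ℂ` of an
elliptic curve by a cyclic subgroup of periods) — abc-iut-L4-t14's `ofOpen` at `ℂ ∖ {0}`, spelled out
reducibly so that its carrier is syntactically the subtype `ℂ ∖ {0}`.
[cite: MochizukiAbsTopIII2015, Definition 2.1 (i) p.50] -/
abbrev puncturedPlane : HolRS :=
  @HolRS.mk (↥puncturedPlaneOpens) _ _
    (isConnected_iff_connectedSpace.1 isConnected_puncturedPlaneOpens) _ _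

/-- `puncturedPlane` IS `ofOpen (ℂ ∖ {0})`. [cite: MochizukiAbsTopIII2015, Definition 2.1 (i) p.50] -/
theorem puncturedPlane_eq_ofOpen :
    puncturedPlane = ofOpen puncturedPlaneOpens isConnected_puncturedPlaneOpens := rfl

/-- The carrier of the punctured plane is the subtype `ℂ ∖ {0}`.
[cite: MochizukiAbsTopIII2015, Definition 2.1 (i) p.50] -/
theorem puncturedPlane_carrier : puncturedPlane.carrier = ↥puncturedPlaneOpens := rfl

/-- The point `1 ∈ ℂ^×`. [cite: MochizukiAbsTopIII2015, Definition 2.1 (i) p.50] -/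
def puncturedPlaneOne : puncturedPlane.carrier := ⟨(1 : ℂ), one_ne_zero⟩

/-! ### Finite étale holomorphic self-maps of `ℂ^×` -/

/-- **The dilations `z ↦ c·z` (`c ≠ 0`) are holomorphic finite étale self-maps of `ℂ^×`** (restrictions
of self-homeomorphisms of `ℂ` preserving `ℂ ∖ {0}`). [cite: MochizukiAbsTopIII2015, Definition 4.1 (iii) p.103] -/
theorem exists_hom_puncturedPlane_mul (c : ℂ) (hc : c ≠ 0) :
    ∃ f : puncturedPlane ⟶ puncturedPlane, ∀ x : puncturedPlane.carrier, (f.toFun x : ℂ) = c * (x : ℂ) := by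
  -- the underlying map
  let φ : puncturedPlane.carrier → puncturedPlane.carrier :=
    fun x => ⟨c * (x : ℂ), mul_ne_zero hc x.2⟩
  -- holomorphic: restriction of `z ↦ c z`
  have hmd : MDifferentiable 𝓘(ℂ, ℂ) 𝓘(ℂ, ℂ) φ :=
    mdifferentiable_opens_of_val_eq' (U := puncturedPlaneOpens) (V := puncturedPlaneOpens)
      (f := fun z : ℂ => c * z)
      ((mdifferentiable_iff_differentiable (f := fun z : ℂ => c * z)).mpr (by fun_prop)) φ
      (fun x => rfl)
  -- finite étale: a self-homeomorphism of `ℂ ∖ {0}`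
  let e : puncturedPlane.carrier ≃ₜ puncturedPlane.carrier :=
    (Homeomorph.mulLeft₀ c hc).subtype (p := fun z : ℂ => z ∈ puncturedPlaneOpens)
      (q := fun z : ℂ => z ∈ puncturedPlaneOpens)
      (fun z => by simp [hc])
  have he : (⇑e : puncturedPlane.carrier → puncturedPlane.carrier) = φ := by
    funext x
    apply Subtype.ext
    rfl
  have hfe : IsFiniteEtale φ := by
    rw [← he]
    exact IsFiniteEtale.of_homeomorph e
  exact ⟨⟨φ, hmd, hfe⟩, fun x => rfl⟩

/-- The set of `n`-th roots of `w` in `ℂ` is finite (`n ≥ 1`). [folklore] -/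
private theorem finite_setOf_pow_eq (n : ℕ) (hn : 0 < n) (w : ℂ) : {z : ℂ | z ^ n = w}.Finite := by
  refine (Polynomial.nthRoots n w).toFinset.finite_toSet.subset fun z hz => ?_
  simp only [Set.mem_setOf_eq] at hz
  simp only [Finset.mem_coe, Multiset.mem_toFinset]
  exact (Polynomial.mem_nthRoots hn).mpr hz

/-- **The power maps `z ↦ zⁿ` (`n ≥ 1`) are holomorphic finite étale self-maps of `ℂ^×`** — genuinely
non-invertible finite étale morphisms of `EA` for `n ≥ 2` ("the finite étale morphisms", Def 4.1 (iii)):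
holomorphic; a covering map (Mathlib `isCoveringMap_npow`: "`(· ^ n) : 𝕜 ∖ {0} → 𝕜 ∖ {0}` is a covering
map") with finite fibres (`n`-th roots). [cite: MochizukiAbsTopIII2015, Definition 4.1 (iii) p.103] -/
theorem exists_hom_puncturedPlane_pow (n : ℕ) (hn : 0 < n) :
    ∃ f : puncturedPlane ⟶ puncturedPlane, ∀ x : puncturedPlane.carrier, (f.toFun x : ℂ) = (x : ℂ) ^ n := by
  let φ : puncturedPlane.carrier → puncturedPlane.carrier :=
    fun x => ⟨(x : ℂ) ^ n, pow_ne_zero n x.2⟩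
  have hmd : MDifferentiable 𝓘(ℂ, ℂ) 𝓘(ℂ, ℂ) φ :=
    mdifferentiable_opens_of_val_eq' (U := puncturedPlaneOpens) (V := puncturedPlaneOpens)
      (f := fun z : ℂ => z ^ n)
      ((mdifferentiable_iff_differentiable (f := fun z : ℂ => z ^ n)).mpr (by fun_prop)) φ
      (fun x => rfl)
  have hcov : IsCoveringMap φ := by
    have hn' : (n : ℂ) ≠ 0 := Nat.cast_ne_zero.mpr (Nat.pos_iff_ne_zero.mp hn)
    exact isCoveringMap_npow (𝕜 := ℂ) n hn'
  have hfin : ∀ y : puncturedPlane.carrier, (φ ⁻¹' {y}).Finite := by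
    intro y
    have hsub : φ ⁻¹' {y} ⊆ Subtype.val ⁻¹' {z : ℂ | z ^ n = (y : ℂ)} := by
      intro x hx
      have hx' : φ x = y := hx
      have := congrArg Subtype.val hx'
      exact this
    exact ((finite_setOf_pow_eq n hn (y : ℂ)).preimage Subtype.val_injective.injOn).subset hsub
  exact ⟨⟨φ, hmd, ⟨hcov, hfin⟩⟩, fun x => rfl⟩

/-- **The squaring map of `ℂ^×` is a finite étale morphism that is NOT an isomorphism** (it identifies
`1` and `-1`): `EA` over the punctured plane has non-invertible morphisms.
[cite: MochizukiAbsTopIII2015, Definition 4.1 (iii) p.103] -/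
theorem exists_hom_puncturedPlane_not_isIso :
    ∃ f : puncturedPlane ⟶ puncturedPlane, ¬ IsIso f := by
  obtain ⟨f, hf⟩ := exists_hom_puncturedPlane_pow 2 two_pos
  refine ⟨f, fun hiso => ?_⟩
  -- an isomorphism has an injective underlying map
  have hinj : Function.Injective f.toFun := by
    intro x y hxy
    have h := congrArg (fun k : puncturedPlane ⟶ puncturedPlane => k.toFun) (IsIso.hom_inv_id f)
    have hx := congrFun h x
    have hy := congrFun h y
    simp only [comp_toFun, Function.comp_apply, id_toFun] at hx hy
    have e := congrArg (inv f).toFun hxy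
    rw [hx, hy] at e
    exact e
  have h1 : f.toFun ⟨(1 : ℂ), one_ne_zero⟩ = f.toFun ⟨(-1 : ℂ), neg_ne_zero.mpr one_ne_zero⟩ := by
    apply Subtype.ext
    rw [hf, hf]
    norm_num
  have h := congrArg Subtype.val (hinj h1)
  norm_num at h

/-! ### Components of automorphisms of the identity functor at `ℂ` and at `ℂ^×` are trivial -/

section Components

variable (Q : ObjectProperty HolRS)

/-- Naturality of an automorphism `α` of `𝟭_{EA^hol_RS(Q)}` along a morphism of underlying surfaces,
pointwise on underlying maps. [cite: MochizukiAbsTopIII2015, Proposition 4.2 (i) p.105] -/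
theorem naturality_toFun (α : 𝟭 (geometricAutHolFieldFunctor Q).EA ≅ 𝟭 (geometricAutHolFieldFunctor Q).EA)
    (P : (geometricAutHolFieldFunctor Q).EA) (f : P.obj ⟶ P.obj) (z : P.obj.carrier) :
    (α.hom.app P).hom.toFun (f.toFun z) = f.toFun ((α.hom.app P).hom.toFun z) := by
  have h := α.hom.naturality (X := P) (Y := P) (InducedCategory.homMk f)
  exact congrArg (fun k => Hom.toFun (InducedCategory.Hom.hom k) z) h

/-- **At the plane**: the component at any object with underlying surface `ℂ` of an automorphism of
`𝟭_{EA^hol_RS(Q)}` is the identity — commuting with the translations `z ↦ z + b` forces `g = (· + g 0)`,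
commuting with the dilation `z ↦ 2z` forces `g 0 = 0`. [cite: MochizukiAbsTopIII2015, Proposition 4.2 (i) p.105] -/
theorem app_eq_id_of_obj_eq_plane
    (α : 𝟭 (geometricAutHolFieldFunctor Q).EA ≅ 𝟭 (geometricAutHolFieldFunctor Q).EA)
    (P : (geometricAutHolFieldFunctor Q).EA) (hP : P.obj = complexPlane) : α.hom.app P = 𝟙 P := by
  obtain ⟨X, hX⟩ := P
  cases hP
  let g : ℂ → ℂ := fun z => (α.hom.app ⟨complexPlane, hX⟩).hom.toFun z
  have hnat : ∀ (f : complexPlane ⟶ complexPlane) (z : ℂ), g (f.toFun z) = f.toFun (g z) :=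
    fun f z => naturality_toFun Q α ⟨complexPlane, hX⟩ f z
  have htr : ∀ b z : ℂ, g (z + b) = g z + b := by
    intro b z
    obtain ⟨t, ht⟩ := exists_hom_plane_affine 1 one_ne_zero b
    have h := hnat t z
    rw [ht, ht, one_mul, one_mul] at h
    exact h
  have hc : ∀ z : ℂ, g z = z + g 0 := by
    intro z
    have h := htr z 0
    rwa [zero_add, add_comm (g 0)] at h
  have h0 : g 0 = 0 := by
    obtain ⟨d, hd⟩ := exists_hom_plane_affine 2 two_ne_zero 0
    have h := hnat d 0
    rw [hd, hd, add_zero, add_zero, mul_zero] at h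
    linear_combination -h
  apply InducedCategory.hom_ext
  apply hom_ext
  funext z
  change g z = z
  rw [hc z, h0, add_zero]

/-- **At the punctured plane**: the component at any object with underlying surface `ℂ^×` of an
automorphism of `𝟭_{EA^hol_RS(Q)}` is the identity — commuting with the dilations forces `g z = d·z`
(`d = g 1`), commuting with the (non-invertible!) squaring map forces `d² = d`, i.e. `d = 1`.
[cite: MochizukiAbsTopIII2015, Proposition 4.2 (i) p.105] -/
theorem app_eq_id_of_obj_eq_puncturedPlane
    (α : 𝟭 (geometricAutHolFieldFunctor Q).EA ≅ 𝟭 (geometricAutHolFieldFunctor Q).EA)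
    (P : (geometricAutHolFieldFunctor Q).EA) (hP : P.obj = puncturedPlane) : α.hom.app P = 𝟙 P := by
  obtain ⟨X, hX⟩ := P
  cases hP
  let g : puncturedPlane.carrier → puncturedPlane.carrier :=
    fun z => (α.hom.app ⟨puncturedPlane, hX⟩).hom.toFun z
  have hnat : ∀ (f : puncturedPlane ⟶ puncturedPlane) (z : puncturedPlane.carrier),
      g (f.toFun z) = f.toFun (g z) :=
    fun f z => naturality_toFun Q α ⟨puncturedPlane, hX⟩ f z
  -- `d := g 1`, a nonzero complex number
  have hd0 : (g puncturedPlaneOne : ℂ) ≠ 0 := (g puncturedPlaneOne).2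
  -- dilations: `g x = x · d`
  have hval : ∀ x : puncturedPlane.carrier, (g x : ℂ) = (x : ℂ) * (g puncturedPlaneOne : ℂ) := by
    intro x
    obtain ⟨m, hm⟩ := exists_hom_puncturedPlane_mul (x : ℂ) x.2
    have hx : m.toFun puncturedPlaneOne = x := by
      apply Subtype.ext
      rw [hm]
      exact mul_one _
    have h := congrArg Subtype.val (hnat m puncturedPlaneOne)
    rw [hx] at h
    -- `h : (g x : ℂ) = (m.toFun (g 1) : ℂ) = x * d`
    rw [h, hm]
  -- squaring: `d = d²`
  have hsq : (g puncturedPlaneOne : ℂ) = (g puncturedPlaneOne : ℂ) ^ 2 := by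
    obtain ⟨s, hs⟩ := exists_hom_puncturedPlane_pow 2 two_pos
    have h1 : s.toFun puncturedPlaneOne = puncturedPlaneOne := by
      apply Subtype.ext
      rw [hs]
      exact one_pow 2
    have h := congrArg Subtype.val (hnat s puncturedPlaneOne)
    rw [h1, hs] at h
    exact h
  have hd1 : (g puncturedPlaneOne : ℂ) = 1 := by
    have h : (g puncturedPlaneOne : ℂ) * ((g puncturedPlaneOne : ℂ) - 1) = 0 := by
      linear_combination (-1 : ℂ) * hsq
    rcases mul_eq_zero.mp h with h | h
    · exact absurd h hd0
    · linear_combination h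
  apply InducedCategory.hom_ext
  apply hom_ext
  funext z
  apply Subtype.ext
  have hz := hval z
  rw [hd1, mul_one] at hz
  exact hz

/-- **`EA^hol_RS(Q)` is id-rigid whenever every object of `Q` is the plane or the punctured plane**
(Prop 4.2 (i) "the categor[y] `EA` … [is] id-rigid", PROVED at these geometric carriers).
[cite: MochizukiAbsTopIII2015, Proposition 4.2 (i) p.105] -/
theorem isIdRigid_EA_of_subset_planes (hQ : ∀ X : HolRS, Q X → X = complexPlane ∨ X = puncturedPlane) :
    IsIdRigid (geometricAutHolFieldFunctor Q).EA := by
  refine isRigidFunctor_of_hom_app_eq_id fun α P => ?_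
  rcases hQ P.obj P.property with h | h
  · exact app_eq_id_of_obj_eq_plane Q α P h
  · exact app_eq_id_of_obj_eq_puncturedPlane Q α P h

/-- **Cor 4.5 (i)–(v) AS TYPED, OUTRIGHT, over any family of geometric carriers drawn from `{ℂ, ℂ^×}`**
containing an object: abc-iut-L4-t14's `cor_4_5_geometric` with its id-rigidity hypothesis discharged.
[cite: MochizukiAbsTopIII2015, Corollary 4.5 pp.107–109] -/
theorem cor_4_5_geometric_of_subset_planes
    (hQ : ∀ X : HolRS, Q X → X = complexPlane ∨ X = puncturedPlane) (X₀ : (geometricAutHolFieldFunctor Q).EA) :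
    Literature.AnabelianGeometry.AbsoluteAnabelian.AbsTopIII.Cor_4_5
      (archLogFrobeniusData (geometricAutHolFieldFunctor Q)) (archTelecoreData (geometricAutHolFieldFunctor Q)) :=
  cor_4_5_geometric Q X₀ (isIdRigid_EA_of_subset_planes Q hQ)

end Components

/-! ### The instance `Q = {ℂ, ℂ^×}` -/

/-- **`EA^hol_RS` on the two carriers `ℂ`, `ℂ^×` is id-rigid** — an `EA` inside genuine geometry with
non-identity automorphisms (translations, dilations) AND non-invertible finite étale morphisms (`z ↦ zⁿ`).
[cite: MochizukiAbsTopIII2015, Proposition 4.2 (i) p.105] -/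
theorem isIdRigid_EA_planes :
    IsIdRigid (geometricAutHolFieldFunctor (fun X : HolRS => X = complexPlane ∨ X = puncturedPlane)).EA :=
  isIdRigid_EA_of_subset_planes _ (fun _ h => h)

/-- **Prop 4.2 (i), id-rigidity of `𝒞^hol_TF` and `𝒞^hol_T` (`T ∈ {TM, TLG, TCG}`), OUTRIGHT over
`{ℂ, ℂ^×}`** (abc-iut-L4-t14's `isIdRigid_pairs_of_isIdRigid_EA`, hypothesis discharged).
[cite: MochizukiAbsTopIII2015, Proposition 4.2 (i) p.105] -/
theorem isIdRigid_pairs_planes {T : ArchPairType} (hT : T.IsMonoidType) :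
    IsIdRigid (HolTFPair
        (geometricAutHolFieldFunctor (fun X : HolRS => X = complexPlane ∨ X = puncturedPlane))) ∧
      IsIdRigid (HolMonoidPair
        (geometricAutHolFieldFunctor (fun X : HolRS => X = complexPlane ∨ X = puncturedPlane)) T) :=
  isIdRigid_pairs_of_isIdRigid_EA _ isIdRigid_EA_planes hT

/-- **[AbsTopIII] Cor 4.5 (i)–(v) AS TYPED hold OUTRIGHT for the archimedean log-Frobenius data over
the geometric carriers `{ℂ, ℂ^×}`.** [cite: MochizukiAbsTopIII2015, Corollary 4.5 pp.107–109] -/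
theorem cor_4_5_geometric_planes :
    Literature.AnabelianGeometry.AbsoluteAnabelian.AbsTopIII.Cor_4_5
      (archLogFrobeniusData
        (geometricAutHolFieldFunctor (fun X : HolRS => X = complexPlane ∨ X = puncturedPlane)))
      (archTelecoreData
        (geometricAutHolFieldFunctor (fun X : HolRS => X = complexPlane ∨ X = puncturedPlane))) :=
  cor_4_5_geometric_of_subset_planes _ (fun _ h => h) ⟨puncturedPlane, Or.inr rfl⟩

end HolRS

end Literature.AnabelianGeometry.AbsoluteAnabelian

end
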